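import Summits.CriticalPhenomena.PercolationContinuityZ3.Theses.PercNearOneGluing
import Literature.Probability.Percolation.PercolationProofs
import Summits.CriticalPhenomena.PercolationContinuityZ3.Theorems.PercNearOneGluingAdditiveGluingLastExitCut
import Summits.CriticalPhenomena.PercolationContinuityZ3.Theorems.PercNearOneGluingAdditiveGluingPocketMarkov
import Summits.CriticalPhenomena.PercolationContinuityZ3.Theorems.PercNearOneGluingAdditiveGluingPartial
import Summits.CriticalPhenomena.PercolationContinuityZ3.Theorems.PercNearOneGluingAdditiveGluingTieLiftOne
import Summits.CriticalPhenomena.PercolationContinuityZ3.Theorems.PercNearOneGluingAdditiveGluingKnLemma2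
import Summits.CriticalPhenomena.PercolationContinuityZ3.Theorems.PercNearOneGluingAdditiveGluingTieLiftTwo
import Summits.CriticalPhenomena.PercolationContinuityZ3.Theorems.PercNearOneGluingAdditiveGluingKnThm2Good
import Summits.CriticalPhenomena.PercolationContinuityZ3.Theorems.PercNearOneGluingAdditiveGluingKnBadBound
import Summits.CriticalPhenomena.PercolationContinuityZ3.Theorems.PercNearOneGluingAdditiveGluingBhkSets
import Summits.CriticalPhenomena.PercolationContinuityZ3.Theorems.PercNearOneGluingAdditiveGluingLemma3Split
import Summits.CriticalPhenomena.PercolationContinuityZ3.Theorems.PercNearOneGluingAdditiveGluingOSourceBound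
import Literature.Probability.Percolation.TwoClusterConditionalAssociation

/-!
# Line `replica-splice-at-entrance` — skeleton v4 (lead c4; v3 by lead c3, v2 by lead c2) for the crux `PercNearOneGluing.AdditiveGluing`

v4 (lead c4, 2026-08-17): the three-relay bad case no longer goes through `stub_knBadBound` + `stub_k3Kernel` (the latter is
FALSE as registered — it fails in the trivial region `P(o↔b) ≥ τ`); it goes through the Lemma-3 split `stub_lemma3Split`
(tool), the o-source bound `stub_oSourceBound` (tool) and the o-pattern kernel `stub_spadeKernel` (open; numerically sound in
both regions); see the section "Skeleton v4" below and `Cruxes/AdditiveGluing/LeadMath-c4.md`.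

Crux item stmt-CriticalPhenomena-4576 (route `route-CriticalPhenomena-PercNearOneGluing`, rank 5; sub-problem
`PercolationContinuityZ3`); idea `replica-splice-at-entrance` (crux-ideate round 1, ideator k = 1); crux-plan by
planner-cruxplan-stmt-CriticalPhenomena-4576-replica-splice-at-en-0 (v1, 2026-08-16); reshaped by the lead
prover-line-stmt-CriticalPhenomena-4576-c2-0 (v2, 2026-08-16): the load-bearing stub is now the AG-EQUIVALENT pocket
inequality `stub_pocketGluing` (v1's `stub_replicaEntrance`, the first-contact bound, is strictly stronger than
Kozma–Nitzan Conjecture 1 on level sets and is kept only as a remark); the two tool stubs are v1's, restated over raw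
tree vocabulary (no local definitions inside a registered signature) so that workers can prove them verbatim in
`Theorems/`.

Crux (FIXED, concluded BY NAME below): on every finite weighted graph (`μ = prodBernoulli w` on the bond configurations of
the complete graph on `Fin n`, events `openConn`), for `0 ≤ t` and `P(a ↔ b) ≥ 1 − t` for all `a ∈ A`:
`P(o ↔ A) − t ≤ P(o ↔ b)`.

Notation. For a relay set `A ∋ b`: the `A`-AVOIDING POCKET `W(ω)` of `o` = the vertices joined to `o` by open paths inside
`Aᶜ` (`pocket`; `= ∅` iff `o ∈ A`), the ENTRANCE SET / first contacts `N(ω) ⊆ A` = points of `A` reached from `o` by an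
open path meeting `A` only at its end (`contacts`; `N ≠ ∅ ↔ o ↔ A`), `G ∖ W` = weights of all pairs meeting `W` set to `0`
(`delV`), `Z(W, N) = P_{G∖W}(N ↔ b)`.

## The line in one paragraph
Explore the cluster of `o` WITHOUT entering `A`; stop at the entrance: what is revealed is the pocket data `(W, N)`.
(i) On `{pocket = W, N}` one has `o ↔ b` iff some first contact reaches `b` OFF the pocket (last-exit decomposition,
`stub_lastExitCut`); (ii) the pairs off `W` are FRESH (spatial Markov property at the entrance stopping set:
`P(pocket = (W,N), N ↔ b off W) = P(pocket = (W,N)) · Z(W,N)`, `stub_pocketMarkov`); hence the exact identity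
`P(o ↔ A, o ↮ b) = Σ_{(W,N), N ≠ ∅} P(pocket = (W,N)) · P_{G∖W}(N ↮ b)` ("live failure = average off-pocket failure of
the entrance set"); (iii) THE BET (`stub_pocketGluing`): that average is at most `t` whenever every relay has
`P(a ↮ b) ≤ t` — which, given (i)–(ii), is EXACTLY the crux for relay sets containing `b` (and the crux for `A` follows
from the crux for `A ∪ {b}`). The composition `AdditiveGluing_of` is the real proof
`P(o ↔ A) − t ≤ μ(N' ≠ ∅) − t ≤ Σ_{N ≠ ∅} μ(W,N)·Z(W,N) ≤ P(o ↔ b)` with `A' = A ∪ {b}`.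

What the lead attacks inside (iii) (see the crux's PICKED.md / NOTES.md): the first open case, three relays + `b`
(5 terminals, 52 partition atoms), by a CERTIFICATE SEARCH for a Kozma–Nitzan-style proof (LP over nonnegative
combinations of BHK one- and two-cluster conditional-association instances, Harris and Lemma-3 rows); two relays + `b` is
KN Theorem 1 (landed by c0/c1 in several forms); the purely linear Lemma-3 closure is already known NOT to suffice at
three relays (extremal pseudo-law `1/3·{oba₁a₂|a₀} + 1/3·{oa₁|ba₀a₂} + 1/3·{oa₂|ba₀a₁}`).

## Disproof used (`Cruxes/AdditiveGluing/Disproof.lean`, cdisprove)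
* `0 ≤ t` needed (only via `A = ∅`) / relay hypothesis needed: honoured — `t ≥ 0` is spent at `b ∈ A'` (`P(b ↔ b) = 1 ≥ 1 − t`)
  and both hypotheses are handed to `stub_pocketGluing` unchanged (the stub is the crux for `A ∋ b`, so neither can be dropped
  there either: `additiveGluing_false_without_nonneg/_relay` apply to it verbatim).
* tightness `o ∈ A` is the equality case: for `o ∈ A'` the pocket is `∅`, `N = {o}`, and (iii) reads `P(o ↮ b) ≤ t`.
* refuted strengthenings (average instead of max; directed analogue): (iii) keeps the max (`t ≥ max_a P(a ↮ b)`); the directed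
  analogue of the identity (ii) is fine but (iii) is false for digraphs (Disproof §(c)), so the proof of (iii) must use the
  symmetry of `↔` — in the certificate search this is where the two-cluster BHK instances enter.
* `|A| ≥ 3 for a counterexample`, `A` = superlevel set WLOG, EdgeDeletion identity (o-adjacent relay): recorded; the 3-relay
  certificate search may assume `o` not adjacent to the worst relay.

## Stubs (v3: 7 registered) and composition
v2's tool stubs `stub_lastExitCut` (p122975) and `stub_pocketMarkov` (p123158) are LANDED and used from `Theorems/` directly.
* `stub_tieLiftOne` (M–L), `stub_tieLiftTwo` (L): the TIE REDUCTION (lead c3, new): WLOG three relays attain the slack.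
* `stub_bhkSets` (L, tool): BHK 1.3/1.4 for clusters of vertex SETS (hub augmentation).
* `stub_knLemma2` (M, tool, takes bhkSets): KN Lemma 2, `φ(1,2) ≥ φ(1) + φ(2)`.
* `stub_knThm2Good` (L, takes bhkSets + knLemma2): KN Theorem 2 ⇒ the three-relay GOOD case (E-form).
* `stub_agThreeBad` (OPEN CORE of the three-relay case, fully tied, bad for every labelling; lead c3: certificate).
* `stub_pocketGluingTied` (OPEN crux residue: four or more relays, three tied, pocket form).
* `AdditiveGluing_of : …PercNearOneGluing.AdditiveGluing` — real composition `stub_tieLiftOne (stub_tieLiftTwo ag_tied3)`.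
-/

noncomputable section

namespace Summit.CriticalPhenomena.PercolationContinuityZ3.Cruxes.AdditiveGluing.ReplicaSpliceAtEntrance

open MeasureTheory Literature.Probability.LatticeModels Literature.Probability.Percolation
open scoped Classical BigOperators

variable {n : ℕ}

/-! ### New stubs of skeleton v3 (lead c3): the tie reduction and the three-relay core -/

/-- **stub_tieLiftOne** (size M–L; NEW reduction, lead c3; tools: one-bond decomposition `stub_oneBondDecomp_k15` /
`real_update_affine` (Theorems/…EdgeAffine, …OneBond), `goodStepEI_prodBernoulli_map_insert`, Mathlib IVT
`intermediate_value_Icc'`). **If additive gluing holds whenever TWO distinct relays attain the slack `t` exactly, it holds.**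
Proof: WLOG `A ≠ ∅` and `t = max_a P(a ↮ b)` attained at `a₀` (the conclusion is monotone in `t`); if another relay attains, done;
else raise the weight `p` of the pair `e = s(a₀, b)` from `w e` towards `1`: every `P_{w[e↦p]}(S)` is affine in `p`;
`g(p) := P_p(a₀ ↮ b) − max_{a ≠ a₀} P_p(a ↮ b)` is continuous, `> 0` at `p = w e`, `≤ 0` at `p = 1`, so it vanishes at some `p*`
(IVT) where two relays attain `t* := P_{p*}(a₀ ↮ b)` and the hypothesis gives `Ψ(p*) ≤ 0` for
`Ψ(p) := P_p(o ↔ A) − P_p(o ↔ b) − P_p(a₀ ↮ b)`; `Ψ` is affine with slope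
`[P₁ − P₀](o ↔ A) − P₀(o ↔ a₀, o ↮ b) + P₀(a₀ ↮ b) ≥ 0` (`P₁(o ↔ b) − P₀(o ↔ b) = P₀(o ↔ a₀, o ↮ b) ≤ P₀(a₀ ↮ b)`), hence
`Ψ(w e) ≤ Ψ(p*) ≤ 0`. (If `a₀ = b` then `t = 0` and every relay is a.s. joined to `b`: union bound.) -/
theorem stub_tieLiftOne :
    (∀ (n : ℕ) (w : Sym2 (Fin n) → unitInterval) (A : Finset (Fin n)) (o b : Fin n) (t : ℝ), 0 ≤ t →
        (∀ a ∈ A, 1 - t ≤ (prodBernoulli w).real (openConn a b)) →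
        (∃ a₀ ∈ A, ∃ a₁ ∈ A, a₀ ≠ a₁ ∧ (prodBernoulli w).real (openConn a₀ b) = 1 - t ∧ (prodBernoulli w).real (openConn a₁ b) = 1 - t) →
        (prodBernoulli w).real (⋃ a ∈ A, openConn o a) - t ≤ (prodBernoulli w).real (openConn o b)) →
      Summit.CriticalPhenomena.PercolationContinuityZ3.Theses.PercNearOneGluing.AdditiveGluing :=
  Summit.CriticalPhenomena.PercolationContinuityZ3.Theorems.stub_tieLiftOne  -- LANDED p128263

/-- **stub_tieLiftTwo** (size L; NEW reduction, lead c3; tools: as `stub_tieLiftOne` for TWO pairs `e₀ = s(a₀,b)`,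
`e₁ = s(a₁,b)`, plus KN Theorem 1 in additive form `additiveGluing_of_card_le_two` (Theorems/…Partial, LANDED)).
**If additive gluing holds whenever THREE distinct relays attain the slack exactly, it holds whenever two do.**
Proof: given two distinct attaining relays `a₀, a₁` (if `A.card ≤ 2` use `additiveGluing_of_card_le_two`; if a third attains, done),
move along the path `y ∈ [0,1] ↦ w_y := w[e₀ ↦ 1 − (1 − w e₀) y, e₁ ↦ 1 − (1 − w e₁) y]` (`y = 1` is `w`). With `ν := P_{w[e₀↦0,e₁↦0]}`,
`α := 1 − w e₀`, `β := 1 − w e₁` every `P_{w_y}(S)` is a polynomial of degree ≤ 2 in `y` (one-bond decomposition twice) and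
`P_{w_y}(a₀ ↮ b) = αy[ν(a₀↮b, a₀↮a₁) + βy·ν(a₀↮b, a₀↔a₁)] = P_{w_y}(a₁ ↮ b)` for ALL `y` (the tie persists).
`g(y) := P_{w_y}(a₀↮b) − max_{a ∉ {a₀,a₁}} P_{w_y}(a↮b)` has `g(1) > 0 ≥ g(0)`, so `g(y*) = 0` for some `y* ∈ [0,1)` (IVT): there three
relays attain and the hypothesis gives `Ψ(y*) ≤ 0`, `Ψ(y) := P_{w_y}(o↔A) − P_{w_y}(o↔b) − P_{w_y}(a₀↮b) = c₀ + c₁y + c₂y²` with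
`c₁ = α ν(o↮b,o↔a₀,o↮a₁) + β ν(o↮b,o↔a₁,o↮a₀) − α ν(a₀↮b,a₀↮a₁)`, `c₂ = αβ[ν(o↮b,o↔a₀,o↔a₁) − ν(o↮A,o↔b) − ν(a₀↮b,a₀↔a₁)]`.
Exact midpoint rule: `Ψ(1) − Ψ(y*) = (1 − y*)(c₁ + 2c₂ȳ)`, `ȳ = (1+y*)/2 ≥ 1/2`, and at the instance `w_ȳ` (where the pair is still
worst and tied, value `f̄`): `ȳ(c₁ + 2c₂ȳ) = x̄₀ + x̄₁ − f̄ − ḡ − 2ū` with `x̄ᵢ = P(o↔aᵢ, o↮b)`, `ḡ = P(a₀↔a₁↮b)`, `ū = P(o↮A, o↔b)`;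
KN Thm 1 (`additiveGluing_of_card_le_two` for the relay set `{a₀,a₁}` at `w_ȳ`) gives `x̄₀ + x̄₁ − P(o↔a₀,o↔a₁,o↮b) ≤ f̄`, and
`P(o↔a₀,o↔a₁,o↮b) ≤ ḡ`, so `Ψ(1) ≤ Ψ(y*) ≤ 0`. -/
theorem stub_tieLiftTwo :
    (∀ (n : ℕ) (w : Sym2 (Fin n) → unitInterval) (A : Finset (Fin n)) (o b : Fin n) (t : ℝ), 0 ≤ t →
        (∀ a ∈ A, 1 - t ≤ (prodBernoulli w).real (openConn a b)) →
        (∃ a₀ ∈ A, ∃ a₁ ∈ A, ∃ a₂ ∈ A, a₀ ≠ a₁ ∧ a₀ ≠ a₂ ∧ a₁ ≠ a₂ ∧ (prodBernoulli w).real (openConn a₀ b) = 1 - t ∧ (prodBernoulli w).real (openConn a₁ b) = 1 - t ∧ (prodBernoulli w).real (openConn a₂ b) = 1 - t) →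
        (prodBernoulli w).real (⋃ a ∈ A, openConn o a) - t ≤ (prodBernoulli w).real (openConn o b)) →
      (∀ (n : ℕ) (w : Sym2 (Fin n) → unitInterval) (A : Finset (Fin n)) (o b : Fin n) (t : ℝ), 0 ≤ t →
        (∀ a ∈ A, 1 - t ≤ (prodBernoulli w).real (openConn a b)) →
        (∃ a₀ ∈ A, ∃ a₁ ∈ A, a₀ ≠ a₁ ∧ (prodBernoulli w).real (openConn a₀ b) = 1 - t ∧ (prodBernoulli w).real (openConn a₁ b) = 1 - t) →
        (prodBernoulli w).real (⋃ a ∈ A, openConn o a) - t ≤ (prodBernoulli w).real (openConn o b)) :=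
  Summit.CriticalPhenomena.PercolationContinuityZ3.Theorems.stub_tieLiftTwo  -- LANDED p128859

/-- **stub_bhkSets** (size L; tool; sources: vdBHK 2006 Thms 1.3/1.4 for the cluster of a vertex SET, as used by
Kozma–Nitzan arXiv:2401.12397 §2.2 ("Let A, B ⊂ G … f, g increasing functions defined on the cluster of A"); tree:
`BHK2006_clusterConditionalPositiveAssociation_holds` (1.3, singleton source, set conditioning) and
`BHK2006_twoClusterConditionalAssociation_holds` / `.negCorrelation` (1.5/1.4, singleton sources)). **BHK for set sources.**
With `C_S(ω) := ⋃ s ∈ S, openEdgeCluster ω s` and `D := {S ↮ X}`: (i) for `F, G` monotone,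
`(∫_D F(C_S))(∫_D G(C_S)) ≤ μ(D)·∫_D F(C_S)·G(C_S)`; (ii) for disjoint `S, S'`, `D' := {S ↮ S'}`, `F, G` monotone:
`μ(D')·∫_{D'} F(C_S)·G(C_{S'}) ≤ (∫_{D'} F(C_S))(∫_{D'} G(C_{S'}))`. Proof: augment the vertex type by a hub `h`
(`Option (Fin n)`), join `h` to `S` by weight-1 pairs (and a second hub to `S'`), all other new pairs weight `0`; the law of the
old pairs is unchanged, `{h ↮ X} = {S ↮ X}` a.s., and `C_h ∩ (old pairs) = C_S` a.s.; apply the singleton theorems on the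
augmented type to `F ∘ (· ∩ old pairs)`. -/
theorem stub_bhkSets :
    (∀ (n : ℕ) (w : Sym2 (Fin n) → unitInterval) (S : Finset (Fin n)) (X : Set (Fin n))
        (F G : Set (Sym2 (Fin n)) → ℝ), Monotone F → Monotone G → (∀ s ∈ S, s ∉ X) →
        (∫ ω in {ω : BondConfig (Fin n) | ∀ s ∈ S, ∀ x ∈ X, ¬ (openGraph ω).Reachable s x},
            F (⋃ s ∈ S, openEdgeCluster ω s) ∂(prodBernoulli w)) *
          (∫ ω in {ω : BondConfig (Fin n) | ∀ s ∈ S, ∀ x ∈ X, ¬ (openGraph ω).Reachable s x},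
            G (⋃ s ∈ S, openEdgeCluster ω s) ∂(prodBernoulli w)) ≤
        (prodBernoulli w).real {ω : BondConfig (Fin n) | ∀ s ∈ S, ∀ x ∈ X, ¬ (openGraph ω).Reachable s x} *
          ∫ ω in {ω : BondConfig (Fin n) | ∀ s ∈ S, ∀ x ∈ X, ¬ (openGraph ω).Reachable s x},
            F (⋃ s ∈ S, openEdgeCluster ω s) * G (⋃ s ∈ S, openEdgeCluster ω s) ∂(prodBernoulli w)) ∧
    (∀ (n : ℕ) (w : Sym2 (Fin n) → unitInterval) (S S' : Finset (Fin n))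
        (F G : Set (Sym2 (Fin n)) → ℝ), Monotone F → Monotone G → Disjoint S S' →
        (prodBernoulli w).real {ω : BondConfig (Fin n) | ∀ s ∈ S, ∀ x ∈ S', ¬ (openGraph ω).Reachable s x} *
          (∫ ω in {ω : BondConfig (Fin n) | ∀ s ∈ S, ∀ x ∈ S', ¬ (openGraph ω).Reachable s x},
            F (⋃ s ∈ S, openEdgeCluster ω s) * G (⋃ s ∈ S', openEdgeCluster ω s) ∂(prodBernoulli w)) ≤
        (∫ ω in {ω : BondConfig (Fin n) | ∀ s ∈ S, ∀ x ∈ S', ¬ (openGraph ω).Reachable s x},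
            F (⋃ s ∈ S, openEdgeCluster ω s) ∂(prodBernoulli w)) *
          (∫ ω in {ω : BondConfig (Fin n) | ∀ s ∈ S, ∀ x ∈ S', ¬ (openGraph ω).Reachable s x},
            G (⋃ s ∈ S', openEdgeCluster ω s) ∂(prodBernoulli w))) :=
  Summit.CriticalPhenomena.PercolationContinuityZ3.Theorems.stub_bhkSets  -- LANDED p129021


/-- **stub_knLemma2** (size M; tool; source: Kozma–Nitzan arXiv:2401.12397 Lemma 2 (p.6) for `X = {1,2} = {1} ∪ {2}`,
via Lemma 1 (i)/(ii) (p.5) = BHK one-cluster association for the cluster of a vertex SET; takes `stub_bhkSets` verbatim as its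
first hypothesis). **Superadditivity `φ(1,2) ≥ φ(1) + φ(2)`**, denominator-free: with `N₁₂ = {A₁₂ ↮ a₃}`, `N₁ = {a₁ ↮ A₂₃}`,
`N₂ = {a₂ ↮ A₁₃}`: `P(o↔a₁, N₁)·P(N₁₂)·P(N₂) + P(o↔a₂, N₂)·P(N₁₂)·P(N₁) ≤ P(o↔A₁₂, N₁₂)·P(N₁)·P(N₂)`.
KN's proof: `M := N₁₂ ∩ N₁ ∩ N₂` (all three separated); `M = Nₖ ∩ Q` with `Q` decreasing in the cluster of `A(Xₖᶜ)`, so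
Lemma 1(i) gives `φ(k) ≤ P(o ↔ aₖ | M)`; the events `{o↔a₁}`, `{o↔a₂}` are disjoint on `M`, so `Σₖ P(o↔aₖ | M) = P(o↔A₁₂ | M)`;
and `M = N₁₂ ∩ Q'` with `Q' = {a₁ ↮ a₂}` decreasing in the cluster of `A₁₂`, so Lemma 1(ii) gives `P(o↔A₁₂ | M) ≤ φ(1,2)`. -/
theorem stub_knLemma2 :
    ((∀ (n : ℕ) (w : Sym2 (Fin n) → unitInterval) (S : Finset (Fin n)) (X : Set (Fin n))
        (F G : Set (Sym2 (Fin n)) → ℝ), Monotone F → Monotone G → (∀ s ∈ S, s ∉ X) →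
        (∫ ω in {ω : BondConfig (Fin n) | ∀ s ∈ S, ∀ x ∈ X, ¬ (openGraph ω).Reachable s x},
            F (⋃ s ∈ S, openEdgeCluster ω s) ∂(prodBernoulli w)) *
          (∫ ω in {ω : BondConfig (Fin n) | ∀ s ∈ S, ∀ x ∈ X, ¬ (openGraph ω).Reachable s x},
            G (⋃ s ∈ S, openEdgeCluster ω s) ∂(prodBernoulli w)) ≤
        (prodBernoulli w).real {ω : BondConfig (Fin n) | ∀ s ∈ S, ∀ x ∈ X, ¬ (openGraph ω).Reachable s x} *
          ∫ ω in {ω : BondConfig (Fin n) | ∀ s ∈ S, ∀ x ∈ X, ¬ (openGraph ω).Reachable s x},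
            F (⋃ s ∈ S, openEdgeCluster ω s) * G (⋃ s ∈ S, openEdgeCluster ω s) ∂(prodBernoulli w)) ∧
    (∀ (n : ℕ) (w : Sym2 (Fin n) → unitInterval) (S S' : Finset (Fin n))
        (F G : Set (Sym2 (Fin n)) → ℝ), Monotone F → Monotone G → Disjoint S S' →
        (prodBernoulli w).real {ω : BondConfig (Fin n) | ∀ s ∈ S, ∀ x ∈ S', ¬ (openGraph ω).Reachable s x} *
          (∫ ω in {ω : BondConfig (Fin n) | ∀ s ∈ S, ∀ x ∈ S', ¬ (openGraph ω).Reachable s x},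
            F (⋃ s ∈ S, openEdgeCluster ω s) * G (⋃ s ∈ S', openEdgeCluster ω s) ∂(prodBernoulli w)) ≤
        (∫ ω in {ω : BondConfig (Fin n) | ∀ s ∈ S, ∀ x ∈ S', ¬ (openGraph ω).Reachable s x},
            F (⋃ s ∈ S, openEdgeCluster ω s) ∂(prodBernoulli w)) *
          (∫ ω in {ω : BondConfig (Fin n) | ∀ s ∈ S, ∀ x ∈ S', ¬ (openGraph ω).Reachable s x},
            G (⋃ s ∈ S', openEdgeCluster ω s) ∂(prodBernoulli w)))) →
      ∀ (n : ℕ) (w : Sym2 (Fin n) → unitInterval) (o a₁ a₂ a₃ : Fin n), a₁ ≠ a₂ → a₁ ≠ a₃ → a₂ ≠ a₃ →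
        (prodBernoulli w).real (openConn o a₁ ∩ ((openConn a₁ a₂)ᶜ ∩ (openConn a₁ a₃)ᶜ)) * (prodBernoulli w).real ((openConn a₁ a₃)ᶜ ∩ (openConn a₂ a₃)ᶜ) * (prodBernoulli w).real ((openConn a₂ a₁)ᶜ ∩ (openConn a₂ a₃)ᶜ) +
          (prodBernoulli w).real (openConn o a₂ ∩ ((openConn a₂ a₁)ᶜ ∩ (openConn a₂ a₃)ᶜ)) * (prodBernoulli w).real ((openConn a₁ a₃)ᶜ ∩ (openConn a₂ a₃)ᶜ) * (prodBernoulli w).real ((openConn a₁ a₂)ᶜ ∩ (openConn a₁ a₃)ᶜ) ≤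
        (prodBernoulli w).real ((openConn o a₁ ∪ openConn o a₂) ∩ ((openConn a₁ a₃)ᶜ ∩ (openConn a₂ a₃)ᶜ)) * (prodBernoulli w).real ((openConn a₁ a₂)ᶜ ∩ (openConn a₁ a₃)ᶜ) * (prodBernoulli w).real ((openConn a₂ a₁)ᶜ ∩ (openConn a₂ a₃)ᶜ) :=
  Summit.CriticalPhenomena.PercolationContinuityZ3.Theorems.stub_knLemma2  -- LANDED p128646

/-- **stub_knThm2Good** (size L; source: Kozma–Nitzan arXiv:2401.12397 Theorem 2 (pp.8–9) + the trivial step (3) ⇒ AG;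
takes `stub_bhkSets` and `stub_knLemma2` verbatim as hypotheses). **The good case of three relays.** If `a₃` is a worst relay
and `m₃ ≤ m₁₂` (`m_S := P(C(b) ∩ A = S)`), then `P(o ↔ A) − t ≤ P(o ↔ b)`. KN: `P(o↔b, o↔A) − P(o↔A, a₃↔b) = I + II + III`
(expand the first by `C(o) ∩ A`, the second by `C(b) ∩ A`, cancel the terms with `o ↔ b ↔ a₃`), six BHK applications give
`I ≥ φ(1,2)(m₁₂ − m₃)`, `II ≥ φ(1)(m₁ − m₂₃)`, `III ≥ φ(2)(m₂ − m₁₃)`; with `m₁₂ ≥ m₃` and Lemma 2, `I ≥ (φ(1)+φ(2))(m₁₂ − m₃)`, so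
`I+II+III ≥ φ(1)(τ₁ − τ₃) + φ(2)(τ₂ − τ₃) ≥ 0`; finally `P(o↔A) − P(o↔b) ≤ P(o↔A) − P(o↔A, o↔b) ≤ P(o↔A) − P(o↔A, a₃↔b) ≤ P(a₃↮b) ≤ t`.
(`φ(1,2) = P(o↔A₁₂ | A₁₂↮a₃)`, `φ(k) = P(o↔aₖ | aₖ ↮ A∖aₖ)`; the one-cluster instances use the cluster of the SET `A₁₂`, the
two-cluster instances the clusters of `A₁₂` and `a₃` — both from the first hypothesis.) -/
theorem stub_knThm2Good :
    ((∀ (n : ℕ) (w : Sym2 (Fin n) → unitInterval) (S : Finset (Fin n)) (X : Set (Fin n))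
        (F G : Set (Sym2 (Fin n)) → ℝ), Monotone F → Monotone G → (∀ s ∈ S, s ∉ X) →
        (∫ ω in {ω : BondConfig (Fin n) | ∀ s ∈ S, ∀ x ∈ X, ¬ (openGraph ω).Reachable s x},
            F (⋃ s ∈ S, openEdgeCluster ω s) ∂(prodBernoulli w)) *
          (∫ ω in {ω : BondConfig (Fin n) | ∀ s ∈ S, ∀ x ∈ X, ¬ (openGraph ω).Reachable s x},
            G (⋃ s ∈ S, openEdgeCluster ω s) ∂(prodBernoulli w)) ≤
        (prodBernoulli w).real {ω : BondConfig (Fin n) | ∀ s ∈ S, ∀ x ∈ X, ¬ (openGraph ω).Reachable s x} *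
          ∫ ω in {ω : BondConfig (Fin n) | ∀ s ∈ S, ∀ x ∈ X, ¬ (openGraph ω).Reachable s x},
            F (⋃ s ∈ S, openEdgeCluster ω s) * G (⋃ s ∈ S, openEdgeCluster ω s) ∂(prodBernoulli w)) ∧
    (∀ (n : ℕ) (w : Sym2 (Fin n) → unitInterval) (S S' : Finset (Fin n))
        (F G : Set (Sym2 (Fin n)) → ℝ), Monotone F → Monotone G → Disjoint S S' →
        (prodBernoulli w).real {ω : BondConfig (Fin n) | ∀ s ∈ S, ∀ x ∈ S', ¬ (openGraph ω).Reachable s x} *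
          (∫ ω in {ω : BondConfig (Fin n) | ∀ s ∈ S, ∀ x ∈ S', ¬ (openGraph ω).Reachable s x},
            F (⋃ s ∈ S, openEdgeCluster ω s) * G (⋃ s ∈ S', openEdgeCluster ω s) ∂(prodBernoulli w)) ≤
        (∫ ω in {ω : BondConfig (Fin n) | ∀ s ∈ S, ∀ x ∈ S', ¬ (openGraph ω).Reachable s x},
            F (⋃ s ∈ S, openEdgeCluster ω s) ∂(prodBernoulli w)) *
          (∫ ω in {ω : BondConfig (Fin n) | ∀ s ∈ S, ∀ x ∈ S', ¬ (openGraph ω).Reachable s x},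
            G (⋃ s ∈ S', openEdgeCluster ω s) ∂(prodBernoulli w)))) →
      (∀ (n : ℕ) (w : Sym2 (Fin n) → unitInterval) (o a₁ a₂ a₃ : Fin n), a₁ ≠ a₂ → a₁ ≠ a₃ → a₂ ≠ a₃ →
        (prodBernoulli w).real (openConn o a₁ ∩ ((openConn a₁ a₂)ᶜ ∩ (openConn a₁ a₃)ᶜ)) * (prodBernoulli w).real ((openConn a₁ a₃)ᶜ ∩ (openConn a₂ a₃)ᶜ) * (prodBernoulli w).real ((openConn a₂ a₁)ᶜ ∩ (openConn a₂ a₃)ᶜ) +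
          (prodBernoulli w).real (openConn o a₂ ∩ ((openConn a₂ a₁)ᶜ ∩ (openConn a₂ a₃)ᶜ)) * (prodBernoulli w).real ((openConn a₁ a₃)ᶜ ∩ (openConn a₂ a₃)ᶜ) * (prodBernoulli w).real ((openConn a₁ a₂)ᶜ ∩ (openConn a₁ a₃)ᶜ) ≤
        (prodBernoulli w).real ((openConn o a₁ ∪ openConn o a₂) ∩ ((openConn a₁ a₃)ᶜ ∩ (openConn a₂ a₃)ᶜ)) * (prodBernoulli w).real ((openConn a₁ a₂)ᶜ ∩ (openConn a₁ a₃)ᶜ) * (prodBernoulli w).real ((openConn a₂ a₁)ᶜ ∩ (openConn a₂ a₃)ᶜ)) →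
      ∀ (n : ℕ) (w : Sym2 (Fin n) → unitInterval) (o b a₁ a₂ a₃ : Fin n) (t : ℝ), a₁ ≠ a₂ → a₁ ≠ a₃ → a₂ ≠ a₃ → b ≠ a₁ → b ≠ a₂ → b ≠ a₃ → 0 ≤ t →
        1 - t ≤ (prodBernoulli w).real (openConn a₁ b) → 1 - t ≤ (prodBernoulli w).real (openConn a₂ b) → 1 - t ≤ (prodBernoulli w).real (openConn a₃ b) →
        (prodBernoulli w).real (openConn a₃ b) ≤ (prodBernoulli w).real (openConn a₁ b) → (prodBernoulli w).real (openConn a₃ b) ≤ (prodBernoulli w).real (openConn a₂ b) →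
        (prodBernoulli w).real (openConn b a₃ ∩ (openConn b a₁)ᶜ ∩ (openConn b a₂)ᶜ) ≤ (prodBernoulli w).real (openConn b a₁ ∩ openConn b a₂ ∩ (openConn b a₃)ᶜ) →
        (prodBernoulli w).real ((⋃ a ∈ ({a₁, a₂, a₃} : Finset (Fin n)), openConn o a) \ openConn o b) ≤ t :=
  Summit.CriticalPhenomena.PercolationContinuityZ3.Theorems.stub_knThm2Good  -- LANDED p129057


/-- **stub_knBadBound** (size M; source: Kozma–Nitzan arXiv:2401.12397 proof of Theorem 2 (pp.8–9) WITHOUT its side condition;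
tools LANDED by wave 1: `stub_knThm2GoodSplit` (the identity `X = I + II + III`, Theorems/…KnThm2GoodEvents), `knThm2_bhkOne/Two`
(the six set-BHK bounds as `μ.real` products, …KnThm2GoodAux) fed by `stub_bhkSets` (…BhkSets)). **KN's six bounds, unconditional,
denominator-free:** with `X := μ(oA ∩ ob) − μ(oA ∩ a₃b)`, `P₁₂ = μ(N₁₂)`, `P₁ = μ(N₁)`, `P₂ = μ(N₂)`, `A₁₂ = μ(N₁₂ ∩ oA₁₂)`, `A₁ = μ(N₁ ∩ oa₁)`,
`A₂ = μ(N₂ ∩ oa₂)` and the patterns `m_S = μ(C(b) ∩ A = S)`: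
`P₁₂P₁P₂·X ≥ P₁P₂A₁₂(m₁₂ − m₃) + P₁₂P₂A₁(m₁ − m₂₃) + P₁₂P₁A₂(m₂ − m₁₃)` (from `P₁₂·I ≥ A₁₂(m₁₂ − m₃)`, `P₁·II ≥ A₁(m₁ − m₂₃)`,
`P₂·III ≥ A₂(m₂ − m₁₃)`, each the difference of a one-cluster lower bound and a two-cluster upper bound, multiplied by the other two
nonnegative `P`'s). No sign hypotheses. -/
theorem stub_knBadBound :
    ∀ (n : ℕ) (w : Sym2 (Fin n) → unitInterval) (o b a₁ a₂ a₃ : Fin n), a₁ ≠ a₂ → a₁ ≠ a₃ → a₂ ≠ a₃ → b ≠ a₁ → b ≠ a₂ → b ≠ a₃ →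
      (prodBernoulli w).real ((openConn a₁ a₂)ᶜ ∩ (openConn a₁ a₃)ᶜ) * (prodBernoulli w).real ((openConn a₂ a₁)ᶜ ∩ (openConn a₂ a₃)ᶜ) * (prodBernoulli w).real ((openConn a₁ a₃)ᶜ ∩ (openConn a₂ a₃)ᶜ ∩ (openConn a₁ o ∪ openConn a₂ o)) * ((prodBernoulli w).real (openConn b a₁ ∩ openConn b a₂ ∩ (openConn b a₃)ᶜ) - (prodBernoulli w).real (openConn b a₃ ∩ (openConn b a₁)ᶜ ∩ (openConn b a₂)ᶜ)) + (prodBernoulli w).real ((openConn a₁ a₃)ᶜ ∩ (openConn a₂ a₃)ᶜ) * (prodBernoulli w).real ((openConn a₂ a₁)ᶜ ∩ (openConn a₂ a₃)ᶜ) * (prodBernoulli w).real ((openConn a₁ a₂)ᶜ ∩ (openConn a₁ a₃)ᶜ ∩ openConn a₁ o) * ((prodBernoulli w).real (openConn b a₁ ∩ (openConn b a₂)ᶜ ∩ (openConn b a₃)ᶜ) - (prodBernoulli w).real (openConn b a₂ ∩ openConn b a₃ ∩ (openConn b a₁)ᶜ)) + (prodBernoulli w).real ((openConn a₁ a₃)ᶜ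 ∩ (openConn a₂ a₃)ᶜ) * (prodBernoulli w).real ((openConn a₁ a₂)ᶜ ∩ (openConn a₁ a₃)ᶜ) * (prodBernoulli w).real ((openConn a₂ a₁)ᶜ ∩ (openConn a₂ a₃)ᶜ ∩ openConn a₂ o) * ((prodBernoulli w).real (openConn b a₂ ∩ (openConn b a₁)ᶜ ∩ (openConn b a₃)ᶜ) - (prodBernoulli w).real (openConn b a₁ ∩ openConn b a₃ ∩ (openConn b a₂)ᶜ)) ≤
        (prodBernoulli w).real ((openConn a₁ a₃)ᶜ ∩ (openConn a₂ a₃)ᶜ) * (prodBernoulli w).real ((openConn a₁ a₂)ᶜ ∩ (openConn a₁ a₃)ᶜ) * (prodBernoulli w).real ((openConn a₂ a₁)ᶜ ∩ (openConn a₂ a₃)ᶜ) * ((prodBernoulli w).real ((openConn o a₁ ∪ openConn o a₂ ∪ openConn o a₃) ∩ openConn o b) - (prodBernoulli w).real ((openConn o a₁ ∪ openConn o a₂ ∪ openConn o a₃) ∩ openConn a₃ b)) :=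
  Summit.CriticalPhenomena.PercolationContinuityZ3.Theorems.stub_knBadBound  -- LANDED p130668

/-! ### Skeleton v4 (lead c4): the three-relay bad case via the Lemma-3 split and the o-pattern kernel

v3's `stub_k3Kernel` (Δ·gap ≤ S') is FALSE as registered: it fails in the trivial region `P(o ↔ b) ≥ τ`
(witness: 5 vertices, `o` glued to `a₁, a₂`, lab/climb_best_j3_5_0_1.json of lead c4: ratio 1e-4), and no
kernel that fails there can follow from valid correlation inequalities.  It is replaced by the following
chain (paper: `Cruxes/AdditiveGluing/LeadMath-c4.md`), all of whose tool steps are instances of the LANDED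
set-BHK theorem `stub_bhkSets` (p129021) and whose residual kernel holds numerically on every tied + bad
instance in BOTH regions (1 400 random instances n = 5,6,7 and adversarial climbs; infimum of the slack
ratio 0⁺ only at the degenerate triple boundary).  Notation (designated relay `a₁`, Lemma-3 relay `a₂`,
leftover relay `a₃`; `π_o := C(o) ∩ (A ∪ {b})`):
`u = μ(o↔b, b↮a₁,a₂,a₃)`, `ρ₃ = μ(o↔b↔a₃, b↮a₁,a₂)`, `S₁ = μ(π_o = ∅, a₁↮b)`, `P₃ = μ(π_o = {a₃}, a₁↔b)`,
`q_S = μ(π_o = S)`.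
* split (`stub_lemma3Split`): tie `τ₂ = τ₁` ⇒ `μ(a₁↮b) − μ(E) ≥ u + ρ₃ + S₁ − P₃`
  (exact bookkeeping + KN Lemma 3(i) with `Q = {o ∈ C(a₂)}`);
* o-source bound (`stub_oSourceBound`, for the intended proof of the kernel): `P₃·q_∅ ≤ q₃·μ(π_o = ∅, a₁↔b)`
  (two-cluster BHK, sources `{o}` vs `{b,a₁,a₂}`);
* kernel (`stub_spadeKernel`, OPEN, lead c4 holds it): ties + bad + `q₃ ≤ q₁, q₂` ⇒ `P₃ ≤ u + ρ₃ + S₁`.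
  Sufficient (and the intended route): `K8'' : q₃·μ(π_o=∅, a₁↔b) ≤ q_∅·(u + ρ₃ + S₁)` (+ `q_∅ = 0 → q₃ = 0`,
  four-functions), itself implied by `K8 : q₃ τ ≤ u + ρ₃ + q_∅ t`.
Composition: `stub_agThreeBad` = case split on `argmin_k q_k` + split + kernel (below, real proof). -/

/-- **stub_lemma3Split** (tool, size M; lead c4).  For the designated relay `a₁`, the Lemma-3 relay `a₂` tied
with it (`μ(a₂↔b) = μ(a₁↔b)`) and the leftover relay `a₃`:
`u + ρ₃ + S₁ − P₃ ≤ μ(a₁ ↮ b) − μ(E)`, `E = {o↔a₁ ∨ o↔a₂ ∨ o↔a₃} ∖ {o↔b}`.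
Proof: `μ(F₁) − μ(E) = μ(F₁ ∖ E) − μ(E ∖ F₁)` (`F₁ = {a₁↮b}`);
`F₁ ∖ E ⊇ ({o↔b} ∩ F₁) ⊔ S₁-event ⊇ (u-event ⊔ ρ₃-event ⊔ R₂) ⊔ S₁-event` with `R₂ = {o↔a₂, a₂↔b, a₂↮a₁}`;
`E ∖ F₁ = L₂ ⊔ P₃-event` with `L₂ = {o↔a₂, a₂↮a₁, a₁↔b}` (split on `o ↔ a₂`; `o↮b ∧ a₁↔b ∧ o↔a₂ ⇒ a₂↮a₁`);
and Kozma–Nitzan Lemma 3(i) `μ(L₂) ≤ μ(R₂)`: with `N = {a₂ ↮ a₁}`, the tools `knThm2_bhkTwo` / `knThm2_bhkOne`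
(Theorems/…KnThm2GoodAux, fed by `stub_bhkSets`, `S = {a₂}`, `S' = X = {a₁}`) give
`μ(N) μ(L₂) ≤ μ(N ∩ oa₂) μ(N ∩ a₁b)` and `μ(N ∩ oa₂) μ(N ∩ a₂b) ≤ μ(N) μ(R₂)`, while the tie gives
`μ(N ∩ a₁b) = μ(N ∩ a₂b)` (on `Nᶜ = {a₁↔a₂}` the events `a₁↔b`, `a₂↔b` coincide); divide by `μ(N)` (if `μ(N) = 0`
both sides vanish). [cite: KozmaNitzan2024, Lemma 3 (i) (p. 6)] -/
theorem stub_lemma3Split :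
    ∀ (n : ℕ) (w : Sym2 (Fin n) → unitInterval) (o b a₁ a₂ a₃ : Fin n), a₁ ≠ a₂ → b ≠ a₁ → b ≠ a₂ →
      (prodBernoulli w).real (openConn a₂ b) = (prodBernoulli w).real (openConn a₁ b) →
      (prodBernoulli w).real (openConn o b ∩ (openConn b a₁)ᶜ ∩ (openConn b a₂)ᶜ ∩ (openConn b a₃)ᶜ) +
          (prodBernoulli w).real (openConn o b ∩ openConn b a₃ ∩ (openConn b a₁)ᶜ ∩ (openConn b a₂)ᶜ) +
          (prodBernoulli w).real ((openConn o a₁)ᶜ ∩ (openConn o a₂)ᶜ ∩ (openConn o a₃)ᶜ ∩ (openConn o b)ᶜ ∩ (openConn a₁ b)ᶜ) -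
          (prodBernoulli w).real (openConn o a₃ ∩ (openConn o a₁)ᶜ ∩ (openConn o a₂)ᶜ ∩ (openConn o b)ᶜ ∩ openConn a₁ b) ≤
        (prodBernoulli w).real ((openConn a₁ b)ᶜ) -
          (prodBernoulli w).real ((openConn o a₁ ∪ openConn o a₂ ∪ openConn o a₃) \ openConn o b) :=
  Summit.CriticalPhenomena.PercolationContinuityZ3.Theorems.stub_lemma3Split  -- LANDED p133918

/-- **stub_oSourceBound** (tool, size S–M; lead c4).  The o-source two-cluster bound for the leftover patterns:
`P₃ · q_∅ ≤ q₃ · μ(π_o = ∅, a₁ ↔ b)` with `q_∅ = μ(o ↮ a₁,a₂,a₃,b)`, `q₃ = μ(o↔a₃, o↮a₁,a₂,b)`,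
`P₃ = μ(o↔a₃, o↮a₁,a₂,b, a₁↔b)`.  Proof: second half of `stub_bhkSets` (vdBHK 2006 Thm 1.4) with `S = {o}`,
`S' = {b, a₁, a₂}`, `N = {o ↮ b, a₁, a₂}`, `F = 1{o ↔ a₃}` (increasing in `C_o`), `G = 1{b ↔ a₁}` (increasing in
`C_{S'}`; at the union cluster use `knThm2_reachable_biUnion_iff` with `b ∈ S'`): `μ(N) μ(N ∩ oa₃ ∩ a₁b) ≤
μ(N ∩ oa₃) μ(N ∩ a₁b)`, and `N = q_∅-event ⊔ q₃-event`, `N ∩ oa₃ = q₃-event`, `N ∩ a₁b = (q_∅-event ∩ a₁b) ⊔ P₃-event`,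
`N ∩ oa₃ ∩ a₁b = P₃-event`. [cite: VandenbergHaggstromKahn2005, Thm. 1.4 (p. 7)] -/
theorem stub_oSourceBound :
    ∀ (n : ℕ) (w : Sym2 (Fin n) → unitInterval) (o b a₁ a₂ a₃ : Fin n), o ≠ b → o ≠ a₁ → o ≠ a₂ →
      (prodBernoulli w).real (openConn o a₃ ∩ (openConn o a₁)ᶜ ∩ (openConn o a₂)ᶜ ∩ (openConn o b)ᶜ ∩ openConn a₁ b) *
          (prodBernoulli w).real ((openConn o a₁)ᶜ ∩ (openConn o a₂)ᶜ ∩ (openConn o a₃)ᶜ ∩ (openConn o b)ᶜ) ≤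
        (prodBernoulli w).real (openConn o a₃ ∩ (openConn o a₁)ᶜ ∩ (openConn o a₂)ᶜ ∩ (openConn o b)ᶜ) *
          (prodBernoulli w).real ((openConn o a₁)ᶜ ∩ (openConn o a₂)ᶜ ∩ (openConn o a₃)ᶜ ∩ (openConn o b)ᶜ ∩ openConn a₁ b) :=
  Summit.CriticalPhenomena.PercolationContinuityZ3.Theorems.stub_oSourceBound  -- LANDED p133864

/-- **stub_spadeKernel** — THE OPEN KERNEL of the three-relay bad case (lead c4; replaces the false `stub_k3Kernel`).
Three relays fully tied (`τᵢ = 1 − t`), bad for every labelling (`m_pair < m_single`), and `a₃` the relay that `o` is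
least likely to hold alone (`q₃ ≤ q₁`, `q₃ ≤ q₂`, `q_k = μ(C(o) ∩ (A ∪ {b}) = {a_k})`): then
`P₃ ≤ u + ρ₃ + S₁`, i.e. `μ(o↔a₃, o↮a₁,a₂,b, a₁↔b) ≤ μ(o↔b, b↮a₁,a₂,a₃) + μ(o↔b↔a₃, b↮a₁,a₂) + μ(o↮a₁,a₂,a₃,b, a₁↮b)`.
Evidence: 0 failures on 1 400 random tied+bad weighted graphs (n = 5,6,7, both regions `P(o↔b) ≶ τ`) and in
adversarial climbs (lab/kspade.py, climb_l6.py, k8.py of lead c4); minimum of (slack / AG-slack) .065.  Why true: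
with `stub_oSourceBound` it follows from `K8'' : q₃ μ(π_o=∅, a₁↔b) ≤ q_∅ (u + ρ₃ + S₁)` (0 failures), which follows from
`K8 : q₃ τ ≤ u + ρ₃ + q_∅ t`; `K8` holds when `q₃ ≤ q_∅` and `τ ≤ ½` (conjecturally automatic in the bad case:
`t − τ = m_∅ − m_123 + Δ ≥ 0` on all instances), and in the rare spread case `q₃ > q_∅` the four-functions bound
`q₃ τ ≤ μ(o↔a₃↔b)·(q₃ + q_∅ ι₃)` (`ι₃ = P_{G∖o}(a₃ ↮ a₁,a₂,b)`) plus `R₃ q₃ ≤ u + ρ₃` (0 failures) does it.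
Why it might fail: it is stronger than AG(3) (it drops the Lemma-3 slack `slack₂ ≥ 0` of the split, numerically ≈ 10 %
of the AG slack at the extremal instances).  It does NOT hold in the good case (not needed there: `stub_knThm2Good`). -/
theorem stub_spadeKernel :
    ∀ (n : ℕ) (w : Sym2 (Fin n) → unitInterval) (o b a₁ a₂ a₃ : Fin n) (t : ℝ), a₁ ≠ a₂ → a₁ ≠ a₃ → a₂ ≠ a₃ → b ≠ a₁ → b ≠ a₂ → b ≠ a₃ → 0 < t → t < 1 →
      (prodBernoulli w).real (openConn a₁ b) = 1 - t → (prodBernoulli w).real (openConn a₂ b) = 1 - t → (prodBernoulli w).real (openConn a₃ b) = 1 - t →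
      (prodBernoulli w).real (openConn b a₁ ∩ openConn b a₂ ∩ (openConn b a₃)ᶜ) < (prodBernoulli w).real (openConn b a₃ ∩ (openConn b a₁)ᶜ ∩ (openConn b a₂)ᶜ) → (prodBernoulli w).real (openConn b a₂ ∩ openConn b a₃ ∩ (openConn b a₁)ᶜ) < (prodBernoulli w).real (openConn b a₁ ∩ (openConn b a₂)ᶜ ∩ (openConn b a₃)ᶜ) → (prodBernoulli w).real (openConn b a₁ ∩ openConn b a₃ ∩ (openConn b a₂)ᶜ) < (prodBernoulli w).real (openConn b a₂ ∩ (openConn b a₁)ᶜ ∩ (openConn b a₃)ᶜ) →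
      (prodBernoulli w).real (openConn o a₃ ∩ (openConn o a₁)ᶜ ∩ (openConn o a₂)ᶜ ∩ (openConn o b)ᶜ) ≤ (prodBernoulli w).real (openConn o a₁ ∩ (openConn o a₂)ᶜ ∩ (openConn o a₃)ᶜ ∩ (openConn o b)ᶜ) →
      (prodBernoulli w).real (openConn o a₃ ∩ (openConn o a₁)ᶜ ∩ (openConn o a₂)ᶜ ∩ (openConn o b)ᶜ) ≤ (prodBernoulli w).real (openConn o a₂ ∩ (openConn o a₁)ᶜ ∩ (openConn o a₃)ᶜ ∩ (openConn o b)ᶜ) →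
      (prodBernoulli w).real (openConn o a₃ ∩ (openConn o a₁)ᶜ ∩ (openConn o a₂)ᶜ ∩ (openConn o b)ᶜ ∩ openConn a₁ b) ≤
        (prodBernoulli w).real (openConn o b ∩ (openConn b a₁)ᶜ ∩ (openConn b a₂)ᶜ ∩ (openConn b a₃)ᶜ) +
          (prodBernoulli w).real (openConn o b ∩ openConn b a₃ ∩ (openConn b a₁)ᶜ ∩ (openConn b a₂)ᶜ) +
          (prodBernoulli w).real ((openConn o a₁)ᶜ ∩ (openConn o a₂)ᶜ ∩ (openConn o a₃)ᶜ ∩ (openConn o b)ᶜ ∩ (openConn a₁ b)ᶜ) := by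
  sorry

/-- One labelled instance of the bad case: designated `a₁`, Lemma-3 relay `a₂`, leftover `a₃ = argmin q`
(split + kernel + `μ(a₁↮b) = t`). -/
theorem agThreeBad_labelled (w : Sym2 (Fin n) → unitInterval) (o b a₁ a₂ a₃ : Fin n) (t : ℝ)
    (h12 : a₁ ≠ a₂) (h13 : a₁ ≠ a₃) (h23 : a₂ ≠ a₃) (hb1 : b ≠ a₁) (hb2 : b ≠ a₂) (hb3 : b ≠ a₃)
    (ht0 : 0 < t) (ht1 : t < 1)
    (e₁ : (prodBernoulli w).real (openConn a₁ b) = 1 - t) (e₂ : (prodBernoulli w).real (openConn a₂ b) = 1 - t)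
    (e₃ : (prodBernoulli w).real (openConn a₃ b) = 1 - t)
    (g₀ : (prodBernoulli w).real (openConn b a₁ ∩ openConn b a₂ ∩ (openConn b a₃)ᶜ) < (prodBernoulli w).real (openConn b a₃ ∩ (openConn b a₁)ᶜ ∩ (openConn b a₂)ᶜ))
    (g₁ : (prodBernoulli w).real (openConn b a₂ ∩ openConn b a₃ ∩ (openConn b a₁)ᶜ) < (prodBernoulli w).real (openConn b a₁ ∩ (openConn b a₂)ᶜ ∩ (openConn b a₃)ᶜ))
    (g₂ : (prodBernoulli w).real (openConn b a₁ ∩ openConn b a₃ ∩ (openConn b a₂)ᶜ) < (prodBernoulli w).real (openConn b a₂ ∩ (openConn b a₁)ᶜ ∩ (openConn b a₃)ᶜ))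
    (hq1 : (prodBernoulli w).real (openConn o a₃ ∩ (openConn o a₁)ᶜ ∩ (openConn o a₂)ᶜ ∩ (openConn o b)ᶜ) ≤ (prodBernoulli w).real (openConn o a₁ ∩ (openConn o a₂)ᶜ ∩ (openConn o a₃)ᶜ ∩ (openConn o b)ᶜ))
    (hq2 : (prodBernoulli w).real (openConn o a₃ ∩ (openConn o a₁)ᶜ ∩ (openConn o a₂)ᶜ ∩ (openConn o b)ᶜ) ≤ (prodBernoulli w).real (openConn o a₂ ∩ (openConn o a₁)ᶜ ∩ (openConn o a₃)ᶜ ∩ (openConn o b)ᶜ)) :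
    (prodBernoulli w).real ((openConn o a₁ ∪ openConn o a₂ ∪ openConn o a₃) \ openConn o b) ≤ t := by
  have hs := stub_lemma3Split n w o b a₁ a₂ a₃ h12 hb1 hb2 (by rw [e₁, e₂])
  have hk := stub_spadeKernel n w o b a₁ a₂ a₃ t h12 h13 h23 hb1 hb2 hb3 ht0 ht1 e₁ e₂ e₃ g₀ g₁ g₂ hq1 hq2
  have hF : (prodBernoulli w).real ((openConn a₁ b)ᶜ) = t := by
    rw [probReal_compl_eq_one_sub MeasurableSet.of_discrete, e₁]; ring
  linarith

/-- A commuted union of three sets. -/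
theorem union3_comm₂ (s₁ s₂ s₃ : Set (BondConfig (Fin n))) : s₂ ∪ s₃ ∪ s₁ = s₁ ∪ s₂ ∪ s₃ := by
  ac_rfl

/-- A commuted union of three sets. -/
theorem union3_comm₃ (s₁ s₂ s₃ : Set (BondConfig (Fin n))) : s₁ ∪ s₃ ∪ s₂ = s₁ ∪ s₂ ∪ s₃ := by
  ac_rfl

/-- **stub_agThreeBad** — the three-relay bad case, PROVED in this skeleton from `stub_lemma3Split` (tool) and the open
kernel `stub_spadeKernel` (lead c4; replaces v3's false `stub_k3Kernel`): choose `a_k = argmin_k q_k`, designate one of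
the other two relays, take the remaining one as the Lemma-3 relay. -/
theorem stub_agThreeBad :
    ∀ (n : ℕ) (w : Sym2 (Fin n) → unitInterval) (o b a₁ a₂ a₃ : Fin n) (t : ℝ), a₁ ≠ a₂ → a₁ ≠ a₃ → a₂ ≠ a₃ → b ≠ a₁ → b ≠ a₂ → b ≠ a₃ → 0 < t → t < 1 →
      (prodBernoulli w).real (openConn a₁ b) = 1 - t → (prodBernoulli w).real (openConn a₂ b) = 1 - t → (prodBernoulli w).real (openConn a₃ b) = 1 - t →
      (prodBernoulli w).real (openConn b a₁ ∩ openConn b a₂ ∩ (openConn b a₃)ᶜ) < (prodBernoulli w).real (openConn b a₃ ∩ (openConn b a₁)ᶜ ∩ (openConn b a₂)ᶜ) → (prodBernoulli w).real (openConn b a₂ ∩ openConn b a₃ ∩ (openConn b a₁)ᶜ) < (prodBernoulli w).real (openConn b a₁ ∩ (openConn b a₂)ᶜ ∩ (openConn b a₃)ᶜ) → (prodBernoulli w).real (openConn b a₁ ∩ openConn b a₃ ∩ (openConn b a₂)ᶜ) < (prodBernoulli w).real (openConn b a₂ ∩ (openConn b a₁)ᶜ ∩ (openConn b a₃)ᶜ)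 →
      (prodBernoulli w).real ((⋃ a ∈ ({a₁, a₂, a₃} : Finset (Fin n)), openConn o a) \ openConn o b) ≤ t := by
  intro n w o b a₁ a₂ a₃ t h12 h13 h23 hb1 hb2 hb3 ht0 ht1 e₁ e₂ e₃ g₀ g₁ g₂
  set μ := prodBernoulli w
  have hU : (⋃ a ∈ ({a₁, a₂, a₃} : Finset (Fin n)), (openConn o a : Set (BondConfig (Fin n)))) = (openConn o a₁ ∪ openConn o a₂ ∪ openConn o a₃) := by
    ext ω
    simp only [Finset.mem_insert, Finset.mem_singleton, Set.mem_iUnion, Set.mem_union, exists_prop]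
    constructor
    · rintro ⟨a, ha, h⟩
      rcases ha with rfl | rfl | rfl
      · exact Or.inl (Or.inl h)
      · exact Or.inl (Or.inr h)
      · exact Or.inr h
    · rintro ((h | h) | h)
      · exact ⟨a₁, Or.inl rfl, h⟩
      · exact ⟨a₂, Or.inr (Or.inl rfl), h⟩
      · exact ⟨a₃, Or.inr (Or.inr rfl), h⟩
  rw [hU]
  -- commuted forms of the single-relay o-patterns
  have cA₁ : (openConn o a₁ ∩ (openConn o a₃)ᶜ ∩ (openConn o a₂)ᶜ ∩ (openConn o b)ᶜ : Set (BondConfig (Fin n))) =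
      openConn o a₁ ∩ (openConn o a₂)ᶜ ∩ (openConn o a₃)ᶜ ∩ (openConn o b)ᶜ := by ac_rfl
  have cA₂ : (openConn o a₂ ∩ (openConn o a₃)ᶜ ∩ (openConn o a₁)ᶜ ∩ (openConn o b)ᶜ : Set (BondConfig (Fin n))) =
      openConn o a₂ ∩ (openConn o a₁)ᶜ ∩ (openConn o a₃)ᶜ ∩ (openConn o b)ᶜ := by ac_rfl
  have cA₃ : (openConn o a₃ ∩ (openConn o a₂)ᶜ ∩ (openConn o a₁)ᶜ ∩ (openConn o b)ᶜ : Set (BondConfig (Fin n))) =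
      openConn o a₃ ∩ (openConn o a₁)ᶜ ∩ (openConn o a₂)ᶜ ∩ (openConn o b)ᶜ := by ac_rfl
  -- commuted forms of the bad-case hypotheses
  have g₀' : μ.real (openConn b a₂ ∩ openConn b a₁ ∩ (openConn b a₃)ᶜ) < μ.real (openConn b a₃ ∩ (openConn b a₂)ᶜ ∩ (openConn b a₁)ᶜ) := by
    have e1 : (openConn b a₂ ∩ openConn b a₁ ∩ (openConn b a₃)ᶜ : Set (BondConfig (Fin n))) = openConn b a₁ ∩ openConn b a₂ ∩ (openConn b a₃)ᶜ := by ac_rfl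
    have e2 : (openConn b a₃ ∩ (openConn b a₂)ᶜ ∩ (openConn b a₁)ᶜ : Set (BondConfig (Fin n))) = openConn b a₃ ∩ (openConn b a₁)ᶜ ∩ (openConn b a₂)ᶜ := by ac_rfl
    rw [e1, e2]; exact g₀
  have g₁' : μ.real (openConn b a₃ ∩ openConn b a₂ ∩ (openConn b a₁)ᶜ) < μ.real (openConn b a₁ ∩ (openConn b a₃)ᶜ ∩ (openConn b a₂)ᶜ) := by
    have e1 : (openConn b a₃ ∩ openConn b a₂ ∩ (openConn b a₁)ᶜ : Set (BondConfig (Fin n))) = openConn b a₂ ∩ openConn b a₃ ∩ (openConn b a₁)ᶜ := by ac_rfl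
    have e2 : (openConn b a₁ ∩ (openConn b a₃)ᶜ ∩ (openConn b a₂)ᶜ : Set (BondConfig (Fin n))) = openConn b a₁ ∩ (openConn b a₂)ᶜ ∩ (openConn b a₃)ᶜ := by ac_rfl
    rw [e1, e2]; exact g₁
  have g₂' : μ.real (openConn b a₃ ∩ openConn b a₁ ∩ (openConn b a₂)ᶜ) < μ.real (openConn b a₂ ∩ (openConn b a₃)ᶜ ∩ (openConn b a₁)ᶜ) := by
    have e1 : (openConn b a₃ ∩ openConn b a₁ ∩ (openConn b a₂)ᶜ : Set (BondConfig (Fin n))) = openConn b a₁ ∩ openConn b a₃ ∩ (openConn b a₂)ᶜ := by ac_rfl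
    have e2 : (openConn b a₂ ∩ (openConn b a₃)ᶜ ∩ (openConn b a₁)ᶜ : Set (BondConfig (Fin n))) = openConn b a₂ ∩ (openConn b a₁)ᶜ ∩ (openConn b a₃)ᶜ := by ac_rfl
    rw [e1, e2]; exact g₂
  rcases le_total (μ.real (openConn o a₃ ∩ (openConn o a₁)ᶜ ∩ (openConn o a₂)ᶜ ∩ (openConn o b)ᶜ))
      (μ.real (openConn o a₁ ∩ (openConn o a₂)ᶜ ∩ (openConn o a₃)ᶜ ∩ (openConn o b)ᶜ)) with h31 | h13'
  · rcases le_total (μ.real (openConn o a₃ ∩ (openConn o a₁)ᶜ ∩ (openConn o a₂)ᶜ ∩ (openConn o b)ᶜ))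
        (μ.real (openConn o a₂ ∩ (openConn o a₁)ᶜ ∩ (openConn o a₃)ᶜ ∩ (openConn o b)ᶜ)) with h32 | h23'
    · -- argmin = a₃ : labelling (a₁, a₂, a₃)
      exact agThreeBad_labelled w o b a₁ a₂ a₃ t h12 h13 h23 hb1 hb2 hb3 ht0 ht1 e₁ e₂ e₃ g₀ g₁ g₂ h31 h32
    · -- argmin = a₂ : labelling (a₁, a₃, a₂)
      have h := agThreeBad_labelled w o b a₁ a₃ a₂ t h13 h12 h23.symm hb1 hb3 hb2 ht0 ht1 e₁ e₃ e₂ g₂ g₁' g₀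
        (by rw [cA₁]; exact h23'.trans h31) (by exact h23')
      rwa [union3_comm₃] at h
  · rcases le_total (μ.real (openConn o a₁ ∩ (openConn o a₂)ᶜ ∩ (openConn o a₃)ᶜ ∩ (openConn o b)ᶜ))
        (μ.real (openConn o a₂ ∩ (openConn o a₁)ᶜ ∩ (openConn o a₃)ᶜ ∩ (openConn o b)ᶜ)) with h12' | h21'
    · -- argmin = a₁ : labelling (a₂, a₃, a₁)
      have h := agThreeBad_labelled w o b a₂ a₃ a₁ t h23 h12.symm h13.symm hb2 hb3 hb1 ht0 ht1 e₂ e₃ e₁ g₁ g₂' g₀'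
        (by rw [cA₂]; exact h12') (by rw [cA₃]; exact h13')
      rwa [union3_comm₂] at h
    · -- argmin = a₂ : labelling (a₁, a₃, a₂)
      have h := agThreeBad_labelled w o b a₁ a₃ a₂ t h13 h12 h23.symm hb1 hb3 hb2 ht0 ht1 e₁ e₃ e₂ g₂ g₁' g₀
        (by rw [cA₁]; exact h21') (by exact h21'.trans h13')
      rwa [union3_comm₃] at h

/-- **stub_pocketGluingTied** — the crux residue for FOUR OR MORE relays, in the line's pocket language (= v2.1's
`stub_pocketGluing` restricted, by the tie reduction, to relay sets in which at least three relays attain the slack exactly;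
open-problem grade). For `b ∈ A`, `0 < t`, `P(a ↔ b) ≥ 1 − t` on `A`, three distinct relays with `P(a ↔ b) = 1 − t`, and
`4 ≤ (A.erase b).card`: `Σ_{W,N} μ{pocket = W, N}·1_{N ≠ ∅}·(1 − P_{G∖W}(N ↔ b)) ≤ t`. -/
theorem stub_pocketGluingTied :
    ∀ (n : ℕ) (w : Sym2 (Fin n) → unitInterval) (A : Finset (Fin n)) (o b : Fin n) (t : ℝ), b ∈ A → 0 < t →
      (∀ a ∈ A, 1 - t ≤ (prodBernoulli w).real (openConn a b)) →
      (∃ a₀ ∈ A, ∃ a₁ ∈ A, ∃ a₂ ∈ A, a₀ ≠ a₁ ∧ a₀ ≠ a₂ ∧ a₁ ≠ a₂ ∧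
        (prodBernoulli w).real (openConn a₀ b) = 1 - t ∧ (prodBernoulli w).real (openConn a₁ b) = 1 - t ∧
        (prodBernoulli w).real (openConn a₂ b) = 1 - t) →
      4 ≤ (A.erase b).card →
      ∑ W : Finset (Fin n), ∑ N : Finset (Fin n),
        (prodBernoulli w).real
            {ω : BondConfig (Fin n) |
              (Finset.univ.filter fun v => ω ∈ openConnIn ((↑A : Set (Fin n))ᶜ) o v) = W ∧
              (A.filter fun a => ω ∈ openConnIn (insert a ((↑A : Set (Fin n))ᶜ)) o a) = N} *
          (if N.Nonempty then
              1 - (prodBernoulli (fun e : Sym2 (Fin n) => if ∃ v ∈ W, v ∈ e then (0 : unitInterval) else w e)).real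
                    (⋃ a ∈ N, openConn a b)
            else 0) ≤ t := by
  sorry

/-! ### Vocabulary of the line (transparent packaging; definitionally the raw terms of the stubs) -/

/-- `G ∖ W`: the weight of every pair meeting the vertex set `W` is set to `0`. -/
def delV (W : Finset (Fin n)) (w : Sym2 (Fin n) → unitInterval) : Sym2 (Fin n) → unitInterval :=
  fun e => if ∃ v ∈ W, v ∈ e then 0 else w e

/-- The `A`-AVOIDING POCKET of `o`. -/
def pocket (A : Finset (Fin n)) (o : Fin n) (ω : BondConfig (Fin n)) : Finset (Fin n) :=
  Finset.univ.filter fun v => ω ∈ openConnIn ((↑A : Set (Fin n))ᶜ) o v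

/-- The ENTRANCE SET (first contacts) `N(ω) ⊆ A`. -/
def contacts (A : Finset (Fin n)) (o : Fin n) (ω : BondConfig (Fin n)) : Finset (Fin n) :=
  A.filter fun a => ω ∈ openConnIn (insert a ((↑A : Set (Fin n))ᶜ)) o a

/-- The pocket data `(W, N)`. -/
def pocketData (A : Finset (Fin n)) (o : Fin n) (ω : BondConfig (Fin n)) :
    Finset (Fin n) × Finset (Fin n) :=
  (pocket A o ω, contacts A o ω)

/-- The event "the pocket is `W` and the entrance set is `N`". -/
def pocketEvent (A : Finset (Fin n)) (o : Fin n) (W N : Finset (Fin n)) : Set (BondConfig (Fin n)) :=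
  {ω | pocket A o ω = W ∧ contacts A o ω = N}

/-- "Some first contact reaches `b` OFF the pocket". -/
def offPocketConn (W N : Finset (Fin n)) (b : Fin n) : Set (BondConfig (Fin n)) :=
  ⋃ a ∈ N, openConnIn ((↑W : Set (Fin n))ᶜ) a b

/-- `Z(W,N) = P_{G ∖ W}(N ↔ b)`. -/
def offPocketRel (w : Sym2 (Fin n) → unitInterval) (W N : Finset (Fin n)) (b : Fin n) : ℝ :=
  (prodBernoulli (delV W w)).real (⋃ a ∈ N, openConn a b)

/-- The stubs in the line's vocabulary (definitional unfoldings). -/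
theorem lastExitCut (A : Finset (Fin n)) (o b : Fin n) (hb : b ∈ A) (W N : Finset (Fin n)) :
    pocketEvent A o W N ∩ openConn o b = pocketEvent A o W N ∩ offPocketConn W N b :=
  Summit.CriticalPhenomena.PercolationContinuityZ3.Theorems.stub_lastExitCut n A o b hb W N  -- LANDED p122975

/-- The Markov property in the line's vocabulary. -/
theorem pocketMarkov (w : Sym2 (Fin n) → unitInterval) (A : Finset (Fin n)) (o b : Fin n)
    (W N : Finset (Fin n)) :
    (prodBernoulli w).real (pocketEvent A o W N ∩ offPocketConn W N b) =
      (prodBernoulli w).real (pocketEvent A o W N) * offPocketRel w W N b :=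
  Summit.CriticalPhenomena.PercolationContinuityZ3.Theorems.stub_pocketMarkov n w A o b W N  -- LANDED p123158


/-- The residual bet in the line's vocabulary (definitional unfolding of `stub_pocketGluingTied`). -/
theorem pocketGluingTied (w : Sym2 (Fin n) → unitInterval) (A : Finset (Fin n)) (o b : Fin n) (t : ℝ)
    (hb : b ∈ A) (ht : 0 < t) (hA : ∀ a ∈ A, 1 - t ≤ (prodBernoulli w).real (openConn a b))
    (h3 : ∃ a₀ ∈ A, ∃ a₁ ∈ A, ∃ a₂ ∈ A, a₀ ≠ a₁ ∧ a₀ ≠ a₂ ∧ a₁ ≠ a₂ ∧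
        (prodBernoulli w).real (openConn a₀ b) = 1 - t ∧ (prodBernoulli w).real (openConn a₁ b) = 1 - t ∧
        (prodBernoulli w).real (openConn a₂ b) = 1 - t)
    (hcard : 4 ≤ (A.erase b).card) :
    ∑ W : Finset (Fin n), ∑ N : Finset (Fin n),
        (prodBernoulli w).real (pocketEvent A o W N) *
          (if N.Nonempty then 1 - offPocketRel w W N b else 0) ≤ t :=
  stub_pocketGluingTied n w A o b t hb ht hA h3 hcard

/-! ### Proved bookkeeping: measurability, partition by pocket data, first entrance -/

/-- Every event of the finite configuration space is measurable. -/
theorem measurableSet_of_fin (s : Set (BondConfig (Fin n))) : MeasurableSet s :=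
  s.toFinite.measurableSet

/-- Partition of an event by the pocket data: `μ(E) = Σ_{W,N} μ({pocket = W, N} ∩ E)`. -/
theorem measureReal_eq_sum_pocketEvent (w : Sym2 (Fin n) → unitInterval) (A : Finset (Fin n))
    (o : Fin n) (E : Set (BondConfig (Fin n))) :
    (prodBernoulli w).real E =
      ∑ W : Finset (Fin n), ∑ N : Finset (Fin n), (prodBernoulli w).real (pocketEvent A o W N ∩ E) := by
  have h1 : ∀ v : Finset (Fin n) × Finset (Fin n),
      MeasurableSet (pocketData A o ⁻¹' {v}) := fun v => measurableSet_of_fin _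
  have h := sum_measureReal_preimage_singleton (μ := (prodBernoulli w).restrict E)
    (Finset.univ : Finset (Finset (Fin n) × Finset (Fin n))) (f := pocketData A o) (fun v _ => h1 v)
  rw [Finset.coe_univ, Set.preimage_univ, measureReal_restrict_apply MeasurableSet.univ,
    Set.univ_inter] at h
  rw [← h, Fintype.sum_prod_type]
  refine Finset.sum_congr rfl fun W _ => Finset.sum_congr rfl fun N _ => ?_
  rw [measureReal_restrict_apply (h1 _)]
  congr 1
  ext ω
  simp only [Set.mem_inter_iff, Set.mem_preimage, Set.mem_singleton_iff, pocketData, pocketEvent,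
    Prod.ext_iff, Set.mem_setOf_eq]

/-- FIRST ENTRANCE: an open path from `o` to a point of `A` meets `A` a first time, so `o ↔ a`, `a ∈ A` imply
`N(ω) ≠ ∅` (induction on an open walk). -/
theorem contacts_nonempty_of_mem_openConn (A : Finset (Fin n)) (o a : Fin n) (ha : a ∈ A)
    (ω : BondConfig (Fin n)) (h : ω ∈ openConn o a) : (contacts A o ω).Nonempty := by
  have key : ∀ (u x : Fin n) (p : (openGraph ω).Walk u x), x ∈ A →
      ∃ a' ∈ A, ω ∈ openConnIn (insert a' ((↑A : Set (Fin n))ᶜ)) u a' := by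
    intro u x p
    induction p with
    | nil =>
      intro hx
      exact ⟨_, hx, Set.mem_insert _ _, Set.mem_insert _ _, SimpleGraph.Reachable.refl _⟩
    | @cons u v x hadj p ih =>
      intro hx
      by_cases hu : u ∈ A
      · exact ⟨u, hu, Set.mem_insert _ _, Set.mem_insert _ _, SimpleGraph.Reachable.refl _⟩
      · obtain ⟨a', ha', hv, hy, hreach⟩ := ih hx
        have hu' : u ∈ insert a' ((↑A : Set (Fin n))ᶜ) :=
          Set.mem_insert_of_mem _ (by simpa using hu)
        refine ⟨a', ha', hu', hy, SimpleGraph.Reachable.trans ?_ hreach⟩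
        refine SimpleGraph.Adj.reachable ?_
        simp only [SimpleGraph.induce, SimpleGraph.comap_adj, Function.Embedding.coe_subtype]
        exact hadj
  obtain ⟨p⟩ := h
  obtain ⟨a', ha', hmem⟩ := key o a p ha
  exact ⟨a', Finset.mem_filter.2 ⟨ha', hmem⟩⟩

/-- `μ(o ↔ A) ≤ μ(N ≠ ∅)`. -/
theorem measureReal_openConn_le_contacts (w : Sym2 (Fin n) → unitInterval) (A : Finset (Fin n))
    (o : Fin n) :
    (prodBernoulli w).real (⋃ a ∈ A, openConn o a) ≤
      (prodBernoulli w).real {ω | (contacts A o ω).Nonempty} := by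
  refine measureReal_mono ?_ (measure_ne_top _ _)
  intro ω hω
  simp only [Set.mem_iUnion, exists_prop] at hω
  obtain ⟨a, ha, h⟩ := hω
  exact contacts_nonempty_of_mem_openConn A o a ha ω h

/-- `Σ_{W,N} μ(W,N)·(N ≠ ∅ ? f(W,N) : 0) = Σ_{W,N} μ({pocket = W,N} ∩ {N ≠ ∅})·f(W,N)`-type bookkeeping:
`c · μ(N ≠ ∅)` as a sum over pocket data. -/
theorem sum_pocketEvent_nonempty (w : Sym2 (Fin n) → unitInterval) (A : Finset (Fin n))
    (o : Fin n) (c : ℝ) :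
    ∑ W : Finset (Fin n), ∑ N : Finset (Fin n),
        (prodBernoulli w).real (pocketEvent A o W N) * (if N.Nonempty then c else 0) =
      c * (prodBernoulli w).real {ω | (contacts A o ω).Nonempty} := by
  rw [measureReal_eq_sum_pocketEvent w A o {ω | (contacts A o ω).Nonempty}, Finset.mul_sum]
  refine Finset.sum_congr rfl fun W _ => ?_
  rw [Finset.mul_sum]
  refine Finset.sum_congr rfl fun N _ => ?_
  by_cases hN : N.Nonempty
  · rw [if_pos hN, mul_comm]
    have hset : pocketEvent A o W N ∩ {ω | (contacts A o ω).Nonempty} = pocketEvent A o W N := by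
      ext ω
      simp only [pocketEvent, Set.mem_inter_iff, Set.mem_setOf_eq]
      constructor
      · rintro ⟨h, -⟩
        exact h
      · intro h
        refine ⟨h, ?_⟩
        rw [h.2]
        exact hN
    rw [hset]
  · rw [if_neg hN, mul_zero]
    have : pocketEvent A o W N ∩ {ω | (contacts A o ω).Nonempty} = ∅ := by
      ext ω
      simp only [pocketEvent, Set.mem_inter_iff, Set.mem_setOf_eq, Set.mem_empty_iff_false,
        iff_false, not_and]
      rintro ⟨-, rfl⟩
      exact hN
    rw [this, measureReal_empty, mul_zero]

/-- For an EMPTY entrance set the off-pocket reliability vanishes: `Z(W, ∅) = 0`. -/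
theorem offPocketRel_empty (w : Sym2 (Fin n) → unitInterval) (W : Finset (Fin n)) (b : Fin n) :
    offPocketRel w W ∅ b = 0 := by
  simp [offPocketRel]

/-! ### The exact identity and the composition -/

/-- **The identity of the line**: `P(o ↔ b) = Σ_{W,N} μ{pocket = W, N} · Z(W, N)` for `b ∈ A`
(partition by pocket data + last exit + Markov). -/
theorem measureReal_openConn_eq_sum (w : Sym2 (Fin n) → unitInterval) (A : Finset (Fin n)) (o b : Fin n)
    (hb : b ∈ A) :
    (prodBernoulli w).real (openConn o b) =
      ∑ W : Finset (Fin n), ∑ N : Finset (Fin n),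
        (prodBernoulli w).real (pocketEvent A o W N) * offPocketRel w W N b := by
  rw [measureReal_eq_sum_pocketEvent w A o (openConn o b)]
  refine Finset.sum_congr rfl fun W _ => Finset.sum_congr rfl fun N _ => ?_
  rw [lastExitCut A o b hb W N, pocketMarkov w A o b W N]


/-! ### Composition (skeleton v3, lead c3) -/

/-- **Union bound over the relay set**: `P(o ↔ A) ≤ P(o ↔ b) + Σ_{a ∈ A} P(a ↮ b)`. -/
theorem measureReal_iUnion_le_add_sum (w : Sym2 (Fin n) → unitInterval) (A : Finset (Fin n)) (o b : Fin n) :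
    (prodBernoulli w).real (⋃ a ∈ A, openConn o a) ≤
      (prodBernoulli w).real (openConn o b) + ∑ a ∈ A, (1 - (prodBernoulli w).real (openConn a b)) := by
  have hsub : (⋃ a ∈ A, (openConn o a : Set (BondConfig (Fin n)))) ⊆
      openConn o b ∪ ⋃ a ∈ A, (openConn a b)ᶜ := by
    intro ω hω
    simp only [Set.mem_iUnion, exists_prop] at hω
    obtain ⟨a, ha, hoa⟩ := hω
    by_cases hab : ω ∈ openConn a b
    · left
      simp only [openConn, Set.mem_setOf_eq] at hoa hab ⊢
      exact hoa.trans hab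
    · right
      simp only [Set.mem_iUnion, exists_prop]
      exact ⟨a, ha, hab⟩
  have hcompl : ∀ a ∈ A, (prodBernoulli w).real ((openConn a b)ᶜ) = 1 - (prodBernoulli w).real (openConn a b) :=
    fun a _ => probReal_compl_eq_one_sub (measurableSet_of_fin _)
  calc (prodBernoulli w).real (⋃ a ∈ A, openConn o a)
      ≤ (prodBernoulli w).real (openConn o b ∪ ⋃ a ∈ A, (openConn a b)ᶜ) := measureReal_mono hsub
    _ ≤ (prodBernoulli w).real (openConn o b) + (prodBernoulli w).real (⋃ a ∈ A, (openConn a b)ᶜ) :=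
        measureReal_union_le _ _
    _ ≤ (prodBernoulli w).real (openConn o b) + ∑ a ∈ A, (prodBernoulli w).real ((openConn a b)ᶜ) := by
        gcongr
        exact measureReal_biUnion_finset_le _ _
    _ = _ := by rw [Finset.sum_congr rfl hcompl]

/-- `t = 0`: every relay is a.s. joined to `b`, and the claim is the union bound. -/
theorem ag_of_t_eq_zero (w : Sym2 (Fin n) → unitInterval) (A : Finset (Fin n)) (o b : Fin n)
    (hA : ∀ a ∈ A, 1 - (0:ℝ) ≤ (prodBernoulli w).real (openConn a b)) :
    (prodBernoulli w).real (⋃ a ∈ A, openConn o a) - 0 ≤ (prodBernoulli w).real (openConn o b) := by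
  have h := measureReal_iUnion_le_add_sum w A o b
  have hs : ∑ a ∈ A, (1 - (prodBernoulli w).real (openConn a b)) ≤ 0 :=
    Finset.sum_nonpos fun a ha => by linarith [hA a ha]
  linarith

/-- A three-element set written in another order. -/
theorem triple_eq₁ (x y z : Fin n) : ({y, z, x} : Finset (Fin n)) = {x, y, z} := by
  ext v; simp only [Finset.mem_insert, Finset.mem_singleton]; tauto

/-- A three-element set written in another order. -/
theorem triple_eq₂ (x y z : Fin n) : ({z, x, y} : Finset (Fin n)) = {x, y, z} := by
  ext v; simp only [Finset.mem_insert, Finset.mem_singleton]; tauto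

/-- A three-element set written in another order. -/
theorem triple_eq₃ (x y z : Fin n) : ({y, x, z} : Finset (Fin n)) = {x, y, z} := by
  ext v; simp only [Finset.mem_insert, Finset.mem_singleton]; tauto

/-- **Three tied relays, exactly three relays besides `b`** (E-form): from `stub_knThm2Good` in the good case of some
labelling and `stub_agThreeBad` otherwise. -/
theorem agE_three_tied (w : Sym2 (Fin n) → unitInterval) (o b a₀ a₁ a₂ : Fin n) (t : ℝ)
    (h01 : a₀ ≠ a₁) (h02 : a₀ ≠ a₂) (h12 : a₁ ≠ a₂) (hb0 : b ≠ a₀) (hb1 : b ≠ a₁) (hb2 : b ≠ a₂)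
    (ht0 : 0 < t) (ht1 : t < 1)
    (e₀ : (prodBernoulli w).real (openConn a₀ b) = 1 - t) (e₁ : (prodBernoulli w).real (openConn a₁ b) = 1 - t)
    (e₂ : (prodBernoulli w).real (openConn a₂ b) = 1 - t) :
    (prodBernoulli w).real ((⋃ a ∈ ({a₀, a₁, a₂} : Finset (Fin n)), openConn o a) \ openConn o b) ≤ t := by
  have hB := stub_bhkSets
  have hL := stub_knLemma2 hB
  set μ := prodBernoulli w with hμ
  -- good cases, one per choice of the designated relay
  by_cases g₀ : μ.real (openConn b a₀ ∩ (openConn b a₁)ᶜ ∩ (openConn b a₂)ᶜ) ≤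
      μ.real (openConn b a₁ ∩ openConn b a₂ ∩ (openConn b a₀)ᶜ)
  · have h := stub_knThm2Good hB hL n w o b a₁ a₂ a₀ t h12 h01.symm h02.symm hb1 hb2 hb0 ht0.le
      (le_of_eq e₁.symm) (le_of_eq e₂.symm) (le_of_eq e₀.symm) (by rw [e₀, e₁]) (by rw [e₀, e₂]) g₀
    rwa [triple_eq₁ a₀ a₁ a₂] at h
  by_cases g₁ : μ.real (openConn b a₁ ∩ (openConn b a₂)ᶜ ∩ (openConn b a₀)ᶜ) ≤
      μ.real (openConn b a₂ ∩ openConn b a₀ ∩ (openConn b a₁)ᶜ)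
  · have h := stub_knThm2Good hB hL n w o b a₂ a₀ a₁ t h02.symm h12.symm h01 hb2 hb0 hb1 ht0.le
      (le_of_eq e₂.symm) (le_of_eq e₀.symm) (le_of_eq e₁.symm) (by rw [e₁, e₂]) (by rw [e₁, e₀]) g₁
    rwa [triple_eq₂ a₀ a₁ a₂] at h
  by_cases g₂ : μ.real (openConn b a₂ ∩ (openConn b a₁)ᶜ ∩ (openConn b a₀)ᶜ) ≤
      μ.real (openConn b a₁ ∩ openConn b a₀ ∩ (openConn b a₂)ᶜ)
  · have h := stub_knThm2Good hB hL n w o b a₁ a₀ a₂ t h01.symm h12 h02 hb1 hb0 hb2 ht0.le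
      (le_of_eq e₁.symm) (le_of_eq e₀.symm) (le_of_eq e₂.symm) (by rw [e₂, e₁]) (by rw [e₂, e₀]) g₂
    rwa [triple_eq₃ a₀ a₁ a₂] at h
  -- bad case for every labelling
  push_neg at g₀ g₁ g₂
  have h := stub_agThreeBad n w o b a₁ a₂ a₀ t h12 h01.symm h02.symm hb1 hb2 hb0 ht0 ht1 e₁ e₂ e₀ g₀ g₁ g₂
  rwa [triple_eq₁ a₀ a₁ a₂] at h

/-- **The pocket route for four or more relays** (v2.1's composition, now fed by `stub_pocketGluingTied`). -/
theorem ag_pocket_route (w : Sym2 (Fin n) → unitInterval) (A : Finset (Fin n)) (o b : Fin n) (t : ℝ)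
    (ht0 : 0 < t) (hA : ∀ a ∈ A, 1 - t ≤ (prodBernoulli w).real (openConn a b))
    (h3 : ∃ a₀ ∈ A, ∃ a₁ ∈ A, ∃ a₂ ∈ A, a₀ ≠ a₁ ∧ a₀ ≠ a₂ ∧ a₁ ≠ a₂ ∧
        (prodBernoulli w).real (openConn a₀ b) = 1 - t ∧ (prodBernoulli w).real (openConn a₁ b) = 1 - t ∧
        (prodBernoulli w).real (openConn a₂ b) = 1 - t)
    (hcard : 4 ≤ (A.erase b).card) :
    (prodBernoulli w).real (⋃ a ∈ A, openConn o a) - t ≤ (prodBernoulli w).real (openConn o b) := by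
  set μ := prodBernoulli w with hμ
  set A' : Finset (Fin n) := insert b A with hA'
  have hb : b ∈ A' := Finset.mem_insert_self b A
  have hsub : A ⊆ A' := Finset.subset_insert b A
  have hA'rel : ∀ a ∈ A', 1 - t ≤ μ.real (openConn a b) := by
    intro a ha
    rcases Finset.mem_insert.1 ha with rfl | ha
    · have : (openConn a a : Set (BondConfig (Fin n))) = Set.univ :=
        Set.eq_univ_iff_forall.2 fun ω => SimpleGraph.Reachable.refl _
      rw [this, probReal_univ]
      linarith
    · exact hA a ha
  have h3' : ∃ a₀ ∈ A', ∃ a₁ ∈ A', ∃ a₂ ∈ A', a₀ ≠ a₁ ∧ a₀ ≠ a₂ ∧ a₁ ≠ a₂ ∧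
      μ.real (openConn a₀ b) = 1 - t ∧ μ.real (openConn a₁ b) = 1 - t ∧ μ.real (openConn a₂ b) = 1 - t := by
    obtain ⟨a₀, h₀, a₁, h₁, a₂, h₂, hr⟩ := h3
    exact ⟨a₀, hsub h₀, a₁, hsub h₁, a₂, hsub h₂, hr⟩
  have hcard' : 4 ≤ (A'.erase b).card := by rwa [hA', Finset.erase_insert_eq_erase]
  have hmonoA : μ.real (⋃ a ∈ A, openConn o a) ≤ μ.real (⋃ a ∈ A', openConn o a) := by
    refine measureReal_mono ?_ (measure_ne_top _ _)
    exact Set.biUnion_subset_biUnion_left fun a ha => hsub ha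
  have hcont := measureReal_openConn_le_contacts w A' o
  set q := μ.real {ω | (contacts A' o ω).Nonempty} with hq
  have hid := measureReal_openConn_eq_sum w A' o b hb
  have hdrop : ∀ W N : Finset (Fin n),
      μ.real (pocketEvent A' o W N) * offPocketRel w W N b =
        μ.real (pocketEvent A' o W N) * (if N.Nonempty then (1 : ℝ) else 0) -
          μ.real (pocketEvent A' o W N) * (if N.Nonempty then 1 - offPocketRel w W N b else 0) := by
    intro W N
    by_cases hN : N.Nonempty
    · rw [if_pos hN, if_pos hN]; ring
    · rw [if_neg hN, if_neg hN, Finset.not_nonempty_iff_eq_empty.1 hN, offPocketRel_empty]; ring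
  have hsum : μ.real (openConn o b) =
      1 * q - ∑ W : Finset (Fin n), ∑ N : Finset (Fin n),
        μ.real (pocketEvent A' o W N) * (if N.Nonempty then 1 - offPocketRel w W N b else 0) := by
    rw [hid, hq, ← sum_pocketEvent_nonempty w A' o 1, ← Finset.sum_sub_distrib]
    refine Finset.sum_congr rfl fun W _ => ?_
    rw [← Finset.sum_sub_distrib]
    exact Finset.sum_congr rfl fun N _ => hdrop W N
  have hbet := pocketGluingTied w A' o b t hb ht0 hA'rel h3' hcard'
  have hq1 : μ.real (⋃ a ∈ A, openConn o a) ≤ q := hmonoA.trans hcont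
  linarith

/-- **The core class: three distinct relays attain the slack.** -/
theorem ag_tied3 :
    ∀ (n : ℕ) (w : Sym2 (Fin n) → unitInterval) (A : Finset (Fin n)) (o b : Fin n) (t : ℝ), 0 ≤ t →
        (∀ a ∈ A, 1 - t ≤ (prodBernoulli w).real (openConn a b)) →
        (∃ a₀ ∈ A, ∃ a₁ ∈ A, ∃ a₂ ∈ A, a₀ ≠ a₁ ∧ a₀ ≠ a₂ ∧ a₁ ≠ a₂ ∧ (prodBernoulli w).real (openConn a₀ b) = 1 - t ∧ (prodBernoulli w).real (openConn a₁ b) = 1 - t ∧ (prodBernoulli w).real (openConn a₂ b) = 1 - t) →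
        (prodBernoulli w).real (⋃ a ∈ A, openConn o a) - t ≤ (prodBernoulli w).real (openConn o b) := by
  intro n w A o b t ht hA h3
  set μ := prodBernoulli w with hμ
  rcases eq_or_lt_of_le ht with rfl | ht0
  · exact ag_of_t_eq_zero w A o b hA
  rcases le_or_gt 1 t with ht1 | ht1
  · have h1 : μ.real (⋃ a ∈ A, openConn o a) ≤ 1 := measureReal_le_one
    have h2 : 0 ≤ μ.real (openConn o b) := measureReal_nonneg
    linarith
  obtain ⟨a₀, h₀, a₁, h₁, a₂, h₂, h01, h02, h12, e₀, e₁, e₂⟩ := h3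
  -- the tied relays are not `b`
  have hself : μ.real (openConn b b) = 1 := by
    have : (openConn b b : Set (BondConfig (Fin n))) = Set.univ :=
      Set.eq_univ_iff_forall.2 fun ω => SimpleGraph.Reachable.refl _
    rw [this, probReal_univ]
  have hb0 : b ≠ a₀ := by rintro rfl; rw [hself] at e₀; linarith
  have hb1 : b ≠ a₁ := by rintro rfl; rw [hself] at e₁; linarith
  have hb2 : b ≠ a₂ := by rintro rfl; rw [hself] at e₂; linarith
  set B := A.erase b with hB
  have hB0 : a₀ ∈ B := Finset.mem_erase.2 ⟨hb0.symm, h₀⟩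
  have hB1 : a₁ ∈ B := Finset.mem_erase.2 ⟨hb1.symm, h₁⟩
  have hB2 : a₂ ∈ B := Finset.mem_erase.2 ⟨hb2.symm, h₂⟩
  have hTsub : ({a₀, a₁, a₂} : Finset (Fin n)) ⊆ B := by
    intro x hx
    simp only [Finset.mem_insert, Finset.mem_singleton] at hx
    rcases hx with rfl | rfl | rfl <;> assumption
  have hTcard : ({a₀, a₁, a₂} : Finset (Fin n)).card = 3 := by
    rw [Finset.card_insert_of_notMem, Finset.card_insert_of_notMem, Finset.card_singleton]
    · simpa using h12
    · simp only [Finset.mem_insert, Finset.mem_singleton, not_or]; exact ⟨h01, h02⟩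
  have h3B : 3 ≤ B.card := hTcard ▸ Finset.card_le_card hTsub
  rcases eq_or_lt_of_le h3B with hc3 | hc4
  · -- exactly three relays besides b: B = {a₀, a₁, a₂}
    have hBeq : ({a₀, a₁, a₂} : Finset (Fin n)) = B :=
      Finset.eq_of_subset_of_card_le hTsub (by rw [hTcard, ← hc3])
    have hE := agE_three_tied w o b a₀ a₁ a₂ t h01 h02 h12 hb0 hb1 hb2 ht0 ht1 e₀ e₁ e₂
    rw [hBeq] at hE
    -- P(o ↔ A) ≤ P(o ↔ b) + P(o ↔ B, o ↮ b)
    have hAB : (⋃ a ∈ A, (openConn o a : Set (BondConfig (Fin n)))) ⊆ openConn o b ∪ ⋃ a ∈ B, openConn o a := by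
      intro ω hω
      simp only [Set.mem_iUnion, exists_prop] at hω
      obtain ⟨a, ha, hoa⟩ := hω
      by_cases hab : a = b
      · left; rwa [hab] at hoa
      · right
        simp only [Set.mem_iUnion, exists_prop]
        exact ⟨a, Finset.mem_erase.2 ⟨hab, ha⟩, hoa⟩
    have h1 : μ.real (⋃ a ∈ A, openConn o a) ≤
        μ.real (openConn o b) + μ.real ((⋃ a ∈ B, openConn o a) \ openConn o b) := by
      calc μ.real (⋃ a ∈ A, openConn o a)
          ≤ μ.real (openConn o b ∪ ⋃ a ∈ B, openConn o a) := measureReal_mono hAB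
        _ ≤ μ.real (openConn o b ∪ ((⋃ a ∈ B, openConn o a) \ openConn o b)) :=
            measureReal_mono (fun ω hω => by
              rcases hω with h | h
              · exact Or.inl h
              · by_cases hb' : ω ∈ openConn o b
                · exact Or.inl hb'
                · exact Or.inr ⟨h, hb'⟩)
        _ ≤ μ.real (openConn o b) + μ.real ((⋃ a ∈ B, openConn o a) \ openConn o b) := measureReal_union_le _ _
    linarith
  · exact ag_pocket_route w A o b t ht0 hA ⟨a₀, h₀, a₁, h₁, a₂, h₂, h01, h02, h12, e₀, e₁, e₂⟩ hc4

/-- **Composition (skeleton v3).** `AdditiveGluing` BY NAME from the registered stubs: the two tie lifts reduce the crux to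
relay sets with three tied worst relays; there, three relays besides `b` is `stub_knThm2Good ∨ stub_agThreeBad` (with the
set-BHK tool and Lemma 2), and four or more is the pocket route `stub_pocketGluingTied` (pocket identity of the line, landed
tool stubs `stub_lastExitCut` p122975 and `stub_pocketMarkov` p123158). -/
theorem AdditiveGluing_of :
    Summit.CriticalPhenomena.PercolationContinuityZ3.Theses.PercNearOneGluing.AdditiveGluing :=
  stub_tieLiftOne (stub_tieLiftTwo ag_tied3)

end Summit.CriticalPhenomena.PercolationContinuityZ3.Cruxes.AdditiveGluing.ReplicaSpliceAtEntrance

end
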